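import Summits.QuantumFields.GaugeBoot.Certificates.SparseReducedWindowP
import HarnessLib

/-!
# Sparse certificate replay, part 5f: WEIGHTED windows (per-variable boxes) and a second block tier with a dual divisor

Cell `ym-instrument` (HOME `run/shared/lean/pub/ym-instrument/`), crew (a), seat `ym-instrument-boot-lean-1` (gen 4); planner work order
P-A5 STAGE 3 «LIMIT ∣ cap kernel replay», sub-item S3a (boot-plan 2026-08-27T14:33:09Z; LEAD A-0826-82). The three R0 «LIMIT ∣ cap»
certificate files of record (`certs/a/files/SU2-D4/kzL2rpLIMcap/*.problem1.json`) differ from the plain class-LIMIT files replayed by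
`Sparse.objective_bound_win_of_le` (`SparseReducedWindowBoundLe`) in exactly two ways: (i) the a-priori boxes are PER VARIABLE,
`|y_v| ≤ ρ_v` with `ρ_v = ρ^{m(v)}` a rational (not `|y_v| ≤ 1`), and (ii) two of the PSD blocks have RATIONAL entries with one common
denominator `q` (the capped difference-Hankel blocks, `λ = ρ = p/q`). This module is the generic kernel support for both, `[folklore]`:

* WEIGHTS. The boxes are carried as integer weights `w : ℕ → ℕ` relative to `w 0`: `|y_v| ≤ w v / w 0` (`v ≠ 0`). The window
  contribution of variable `v` becomes `g_0 = −N_0 · w 0`, `g_v = |N_v| · w v` (`gSpecW`), checked per window against ONE emitted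
  integer exactly as before (`winCheckPW` → `WinOKW`, `WinOKW.append`), and the final scalar check reads
  `lower ≤ (rhs_N · 4^K · q · w 0 − S) / (D · 4^K · q · w 0)` (`finalCheckWW`).
* SECOND TIER. Besides the family table `EB` (Gram duals `Z_k = G_k G_kᵀ / 4^K`) a second table `EB₂` of `nb₂` blocks is swept by
  the SAME early-exit sweep `sweepP` (part 5e) into a second trie; its duals are `Z_k = G_k G_kᵀ / (4^K · q)` for ONE integer divisor
  `q ≥ 1`, so a block with rational entries of denominator `q` is stored ×`q` (integer; PSD-invariant) and its Gram dual unchanged.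
  The residual numerator is `N_v = (c_v · D − n_v) · 4^K · q − (t_v · q + u_v) · D` (`t_v`, `u_v` the two tries' trace values;
  `resNW`), the residual `r_v = N_v / (D · 4^K · q)`.

The assembled bound `objective_boundW_of_le` (ONE aggregated one-sided row, as `objective_bound_win_of_le`) and its equality twin
`objective_boundW` are `JanssonChaykinKeil.lmiForm_bound` with its general box slot `ρ_v := w v / w 0` and block index `Fin nb ⊕ Fin nb₂`
(both tiers padded to the same `m`); hypotheses: `WinOKW … 0 (nv+1) S`, `finalCheckWW`, `lenCheckAll`/`dimCheck` for both tiers,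
`y_0 = 1`, the boxes, the aggregated row, all blocks of both tiers PSD in their own dimensions (`redE`). With `w = 1`, `q = 1`,
`nb₂ = 0` this is literally part 5c. Nothing here is specific to lattice gauge theory.

HONEST FRAMING (cells `pub-gaugeboot` / `ym-instrument`): certified bounds on lattice expectations at stated coupling, gauge group,
dimension and torus size / class LIMIT; NOT a mass gap, NOT a continuum limit, NOT a string tension; NOT Yang–Mills-summit-bearing
(barriers `FixedCouplingUltralocality`, `PerturbativeInvisibility`). This module certifies nothing by itself.
-/

namespace Summit.QuantumFields.GaugeBoot.Certificates.Sparse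

open Matrix Finset Literature.Computation.Certificates

noncomputable section

/-! ## Two-tier weighted residual numerators and window contributions -/

/-- Two-tier residual NUMERATOR `N_v = (c_v · D − n_v) · P · q − (t_v · q + u_v) · D` (`P = 4^K`; `t_v` = trace value of the
family table, `u_v` = trace value of the second tier whose duals carry the extra divisor `q`; the residual is `N_v / (D · P · q)`).
[folklore] -/
def resNW (GB : List (List (List ℤ))) (EB : List (List (List (List (ℕ × ℤ))))) (nb m : ℕ)
    (GB₂ : List (List (List ℤ))) (EB₂ : List (List (List (List (ℕ × ℤ))))) (nb₂ : ℕ)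
    (cZ : List (ℕ × ℤ)) (RN : List ℤ) (P D q : ℤ) (v : ℕ) : ℤ :=
  (coef cZ v * D - RN.getD v 0) * P * q - (trZ GB EB nb m v * q + trZ GB₂ EB₂ nb₂ m v) * D

/-- WEIGHTED window contribution of variable `v` (specification): `−N_0 · w 0` for `v = 0`, `|N_v| · w v` otherwise. [folklore] -/
def gSpecW (GB : List (List (List ℤ))) (EB : List (List (List (List (ℕ × ℤ))))) (nb m : ℕ)
    (GB₂ : List (List (List ℤ))) (EB₂ : List (List (List (List (ℕ × ℤ))))) (nb₂ : ℕ)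
    (cZ : List (ℕ × ℤ)) (RN : List ℤ) (P D q : ℤ) (w : ℕ → ℕ) (v : ℕ) : ℤ :=
  (if v = 0 then -resNW GB EB nb m GB₂ EB₂ nb₂ cZ RN P D q v else |resNW GB EB nb m GB₂ EB₂ nb₂ cZ RN P D q v|) * (w v : ℤ)

/-- Kernel form of the two-tier numerator from the integer data of one variable (explicit `Int.*` operations). [folklore] -/
def numW (P D q c n t u : ℤ) : ℤ :=
  Int.sub (Int.mul (Int.mul (Int.sub (Int.mul c D) n) P) q) (Int.mul (Int.add (Int.mul t q) u) D)

/-- Kernel form of the weighted contribution. [folklore] -/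
def gZW (P D q : ℤ) (v : ℕ) (c n t u : ℤ) (wv : ℕ) : ℤ :=
  Int.mul (bif Nat.beq v 0 then Int.neg (numW P D q c n t u) else (Int.natAbs (numW P D q c n t u) : ℤ)) (Int.ofNat wv)

/-- `Nat.beq a b = false` from `a ≠ b`. [folklore] -/
private theorem nat_beq_false'' {a b : ℕ} (h : a ≠ b) : Nat.beq a b = false := by
  cases hq : Nat.beq a b
  · rfl
  · exact absurd (Nat.eq_of_beq_eq_true hq) h

/-- `gZW` is `gSpecW` once `t`, `u` are the two trace values and `wv = w v`. [folklore] -/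
theorem gZW_eq (GB : List (List (List ℤ))) (EB : List (List (List (List (ℕ × ℤ))))) (nb m : ℕ)
    (GB₂ : List (List (List ℤ))) (EB₂ : List (List (List (List (ℕ × ℤ))))) (nb₂ : ℕ)
    (cZ : List (ℕ × ℤ)) (RN : List ℤ) (P D q : ℤ) (w : ℕ → ℕ) (v : ℕ) :
    gZW P D q v (coef cZ v) (RN.getD v 0) (trZ GB EB nb m v) (trZ GB₂ EB₂ nb₂ m v) (w v) =
      gSpecW GB EB nb m GB₂ EB₂ nb₂ cZ RN P D q w v := by
  have hr : numW P D q (coef cZ v) (RN.getD v 0) (trZ GB EB nb m v) (trZ GB₂ EB₂ nb₂ m v) =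
      resNW GB EB nb m GB₂ EB₂ nb₂ cZ RN P D q v := rfl
  rw [gZW, hr, gSpecW]
  by_cases hv : v = 0
  · subst hv; rfl
  · rw [nat_beq_false'' hv, if_neg hv, cond_false, Int.natCast_natAbs]; rfl

/-! ## The weighted residual walk over two tries -/

/-- Weighted residual walk with shifted trie keys (`v − lo`) over the two tier tries; the accumulator is forced after every step.
[folklore] -/
def resWalkEW (d lo : ℕ) (trA trB : Trie) (cZ : List (ℕ × ℤ)) (P D q : ℤ) (w : ℕ → ℕ) (n : ℕ) :
    List ℤ → ℕ → ℤ → ℤ :=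
  @Nat.rec (fun _ => List ℤ → ℕ → ℤ → ℤ) (fun _ _ acc => acc)
    (fun _ ih ns v acc =>
      @Int.casesOn (fun _ => ℤ)
        (Int.add acc (gZW P D q v (coef cZ v) (ns.headD 0) (Trie.getR d trA (Nat.sub v lo))
          (Trie.getR d trB (Nat.sub v lo)) (w v)))
        (fun _ => ih ns.tail (v + 1) (Int.add acc (gZW P D q v (coef cZ v) (ns.headD 0)
          (Trie.getR d trA (Nat.sub v lo)) (Trie.getR d trB (Nat.sub v lo)) (w v))))
        (fun _ => ih ns.tail (v + 1) (Int.add acc (gZW P D q v (coef cZ v) (ns.headD 0)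
          (Trie.getR d trA (Nat.sub v lo)) (Trie.getR d trB (Nat.sub v lo)) (w v)))))
    n

/-- Unfolding `resWalkEW` one step. [folklore] -/
theorem resWalkEW_succ (d lo : ℕ) (trA trB : Trie) (cZ : List (ℕ × ℤ)) (P D q : ℤ) (w : ℕ → ℕ) (n : ℕ)
    (ns : List ℤ) (v : ℕ) (acc : ℤ) : resWalkEW d lo trA trB cZ P D q w (n + 1) ns v acc =
      resWalkEW d lo trA trB cZ P D q w n ns.tail (v + 1)
        (acc + gZW P D q v (coef cZ v) (ns.headD 0) (Trie.getR d trA (v - lo)) (Trie.getR d trB (v - lo)) (w v)) := by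
  have key : ∀ (A E : ℤ), @Int.casesOn (fun _ => ℤ) A (fun _ => E) (fun _ => E) = E := fun A E => by
    cases A <;> rfl
  exact key _ _

/-- `(l.drop v).headD 0 = l[v]` (default `0`). [folklore] -/
private theorem headD_drop'' : ∀ (l : List ℤ) (v : ℕ), (l.drop v).headD 0 = l.getD v 0
  | [], v => by simp
  | a :: l, 0 => by simp
  | a :: l, v + 1 => by rw [List.drop_succ_cons, headD_drop'' l v, List.getD_cons_succ]

/-- Semantics of `resWalkEW`. [folklore] -/
theorem resWalkEW_eq (d lo : ℕ) (trA trB : Trie) (cZ : List (ℕ × ℤ)) (P D q : ℤ) (w : ℕ → ℕ) (RN : List ℤ) :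
    ∀ (n v : ℕ) (acc : ℤ), resWalkEW d lo trA trB cZ P D q w n (RN.drop v) v acc =
      acc + ∑ i ∈ Finset.range n,
        gZW P D q (v + i) (coef cZ (v + i)) (RN.getD (v + i) 0) (Trie.getR d trA (v + i - lo))
          (Trie.getR d trB (v + i - lo)) (w (v + i))
  | 0, v, acc => by simp [resWalkEW]
  | n + 1, v, acc => by
    rw [resWalkEW_succ, List.tail_drop, headD_drop'', resWalkEW_eq d lo trA trB cZ P D q w RN n (v + 1),
      Finset.sum_range_succ', add_assoc, add_comm (∑ i ∈ Finset.range n, _)]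
    simp only [Nat.add_zero, Nat.add_right_comm v 1, Nat.add_assoc]

/-! ## Weighted two-tier window check -/

/-- **Weighted two-tier window check** (early exit, sign-dispatch dot products, family tables without offset): `lo ≤ hi`,
`hi − lo ≤ 2^d`, one `sweepP` per tier over the shifted window, weighted residual walk on the GLOBAL indices `lo ≤ v < hi`,
comparison with the emitted integer `s`. [folklore] -/
def winCheckPW (GB : List (List (List ℤ))) (EB : List (List (List (List (ℕ × ℤ))))) (nb m : ℕ)
    (GB₂ : List (List (List ℤ))) (EB₂ : List (List (List (List (ℕ × ℤ))))) (nb₂ : ℕ) (d : ℕ)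
    (cZ : List (ℕ × ℤ)) (RN : List ℤ) (P D q : ℤ) (w : ℕ → ℕ) (lo hi : ℕ) (s : ℤ) : Bool :=
  decide (lo ≤ hi) && decide (hi - lo ≤ 2 ^ d) &&
    decide (resWalkEW d lo (sweepP GB EB nb m d lo hi) (sweepP GB₂ EB₂ nb₂ m d lo hi) cZ P D q w (hi - lo)
      (RN.drop lo) lo 0 = s)

/-- What a weighted window check establishes: `lo ≤ hi` and `s = Σ_{lo ≤ v < hi} gSpecW v`. [folklore] -/
def WinOKW (GB : List (List (List ℤ))) (EB : List (List (List (List (ℕ × ℤ))))) (nb m : ℕ)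
    (GB₂ : List (List (List ℤ))) (EB₂ : List (List (List (List (ℕ × ℤ))))) (nb₂ : ℕ)
    (cZ : List (ℕ × ℤ)) (RN : List ℤ) (P D q : ℤ) (w : ℕ → ℕ) (lo hi : ℕ) (s : ℤ) : Prop :=
  lo ≤ hi ∧ s = ∑ i ∈ Finset.range (hi - lo), gSpecW GB EB nb m GB₂ EB₂ nb₂ cZ RN P D q w (lo + i)

/-- Sweep semantics of `sweepP` with the family table itself (`H = 0`): key `i < hi − lo ≤ 2^d` holds `trZ EB (lo + i)`.
[folklore] -/
theorem getR_sweepP0 {GB : List (List (List ℤ))} {EB : List (List (List (List (ℕ × ℤ))))} {nb m d lo hi : ℕ}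
    (hsort : sortedCheck EB = true) (hrow : rowLenCheck EB m nb = true) (hd : hi - lo ≤ 2 ^ d) {i : ℕ}
    (hi' : i < hi - lo) : (sweepP GB EB nb m d lo hi).getR d i = trZ GB EB nb m (lo + i) := by
  rw [sweepP_eq GB hsort, getR_sweepR (by rw [rowLenCheck_EBshift]; exact hrow) hd (Nat.zero_le _) hi',
    trZ_shift GB EB nb m lo hi hi']

/-- **Soundness of `winCheckPW`** (both tiers sorted and row-length checked): `WinOKW`. [folklore] -/
theorem winOKW_of_checkPW0 {GB : List (List (List ℤ))} {EB : List (List (List (List (ℕ × ℤ))))} {nb m : ℕ}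
    {GB₂ : List (List (List ℤ))} {EB₂ : List (List (List (List (ℕ × ℤ))))} {nb₂ d : ℕ}
    {cZ : List (ℕ × ℤ)} {RN : List ℤ} {P D q : ℤ} {w : ℕ → ℕ} {lo hi : ℕ} {s : ℤ}
    (hsort : sortedCheck EB = true) (hrow : rowLenCheck EB m nb = true)
    (hsort₂ : sortedCheck EB₂ = true) (hrow₂ : rowLenCheck EB₂ m nb₂ = true)
    (h : winCheckPW GB EB nb m GB₂ EB₂ nb₂ d cZ RN P D q w lo hi s = true) :
    WinOKW GB EB nb m GB₂ EB₂ nb₂ cZ RN P D q w lo hi s := by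
  rw [winCheckPW, Bool.and_eq_true, Bool.and_eq_true, decide_eq_true_eq, decide_eq_true_eq, decide_eq_true_eq] at h
  obtain ⟨⟨hlh, hd⟩, hs⟩ := h
  refine ⟨hlh, ?_⟩
  rw [← hs, resWalkEW_eq, zero_add]
  refine Finset.sum_congr rfl fun i hi' => ?_
  rw [Finset.mem_range] at hi'
  rw [show lo + i - lo = i by omega, getR_sweepP0 hsort hrow hd hi', getR_sweepP0 hsort₂ hrow₂ hd hi', gZW_eq]

/-- Concatenating weighted windows. [folklore] -/
theorem WinOKW.append {GB : List (List (List ℤ))} {EB : List (List (List (List (ℕ × ℤ))))} {nb m : ℕ}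
    {GB₂ : List (List (List ℤ))} {EB₂ : List (List (List (List (ℕ × ℤ))))} {nb₂ : ℕ}
    {cZ : List (ℕ × ℤ)} {RN : List ℤ} {P D q : ℤ} {w : ℕ → ℕ} {lo mid hi : ℕ} {s₁ s₂ : ℤ}
    (h1 : WinOKW GB EB nb m GB₂ EB₂ nb₂ cZ RN P D q w lo mid s₁)
    (h2 : WinOKW GB EB nb m GB₂ EB₂ nb₂ cZ RN P D q w mid hi s₂) :
    WinOKW GB EB nb m GB₂ EB₂ nb₂ cZ RN P D q w lo hi (s₁ + s₂) := by
  obtain ⟨hlm, hs1⟩ := h1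
  obtain ⟨hmh, hs2⟩ := h2
  refine ⟨le_trans hlm hmh, ?_⟩
  rw [hs1, hs2, show hi - lo = (mid - lo) + (hi - mid) by omega, Finset.sum_range_add]
  congr 1
  refine Finset.sum_congr rfl fun i _ => ?_
  rw [show lo + (mid - lo + i) = mid + i by omega]

/-! ## The assembled weighted two-tier bound -/

/-- Final scalar check of the weighted two-tier route: `lower ≤ (rhs_N · 4^K · q · W₀ − S) / (D · 4^K · q · W₀)`. [folklore] -/
def finalCheckWW (rhsN S : ℤ) (D K q W₀ : ℕ) (lower : ℚ) : Bool :=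
  decide (lower ≤ ((rhsN * 4 ^ K * q * W₀ - S : ℤ) : ℚ) / ((D : ℚ) * 4 ^ K * q * W₀))

/-- **Summed trace identity of the second tier**: with duals `Z_k = G_k G_kᵀ / (4^K · q)`,
`Σ_k tr (Z_k · F⁽ᵏ⁾_v) = trZ₂ v / (4^K · q)`. [folklore] -/
theorem sum_trace_zr_div_mul_fzE_eq_trZ (GB₂ : List (List (List ℤ))) (EB₂ : List (List (List (List (ℕ × ℤ)))))
    (nb₂ m K : ℕ) (q : ℝ) {nv : ℕ} (v : Fin nv) :
    ∑ k : Fin nb₂, trace (((1 : ℝ) / q) • zr (GB₂.getD k.val []) m K * (fzE EB₂ k.val m v.val).map (Int.cast : ℤ → ℝ)) =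
      ((trZ GB₂ EB₂ nb₂ m v.val : ℤ) : ℝ) / 4 ^ K / q := by
  simp_rw [Matrix.smul_mul, Matrix.trace_smul, smul_eq_mul, ← Finset.mul_sum]
  rw [sum_trace_zr_mul_fzE_eq_trZ GB₂ EB₂ nb₂ m K v]
  ring

/-- **Certified lower bound on the objective — reduced blocks in two tiers, WEIGHTED windowed residuals, ONE aggregated
INEQUALITY row.** For integer objective coefficients `c_v = coef cZ v`, ONE aggregated row known as a lower bound
`rhs_N / D ≤ Σ_v (n_v / D) y_v` (`n_v = RN[v]`), Gram duals from the factor rows `GB` (tier one, `Z = G Gᵀ/4^K`) and `GB₂`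
(tier two, `Z = G Gᵀ/(4^K q)`), reduced entry tables `EB`, `EB₂` (both padded to `m`), integer weights `w` with `0 < w 0`, the
weighted window statement `WinOKW … 0 (nv+1) S` and the scalar check `finalCheckWW rhsN S D K q (w 0) lower`: every real `y` with
`y_0 = 1`, `|y_v| ≤ w v / w 0` (`v ≠ 0`), the aggregated inequality and all blocks of both tiers PSD satisfies `lower ≤ c · y`.
(Proof: `JanssonChaykinKeil.lmiForm_bound`, box slot `ρ_v = w v / w 0`, block index `Fin nb ⊕ Fin nb₂`, `I := Fin 1`, `rowI = −a`,
`upper = −rhs_N/D`, `κ = 1`, residuals `r_v = N_v / (D · 4^K · q)`.) [folklore] -/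
theorem objective_boundW_of_le {nv nb nb₂ m K D q : ℕ} (cZ : List (ℕ × ℤ)) (RN : List ℤ) (rhsN : ℤ)
    (GB : List (List (List ℤ))) (EB : List (List (List (List (ℕ × ℤ))))) (dimL : List ℕ)
    (GB₂ : List (List (List ℤ))) (EB₂ : List (List (List (List (ℕ × ℤ))))) (dimL₂ : List ℕ)
    (w : ℕ → ℕ) (lower : ℚ) (S : ℤ)
    (hD : 0 < D) (hq : 0 < q) (hw0 : 0 < w 0)
    (hwin : WinOKW GB EB nb m GB₂ EB₂ nb₂ cZ RN ((4 : ℤ) ^ K) (D : ℤ) (q : ℤ) w 0 (nv + 1) S)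
    (hfin : finalCheckWW rhsN S D K q (w 0) lower = true)
    (hlen : lenCheckAll GB m nb = true) (hdim : dimCheck EB dimL m nb = true)
    (hlen₂ : lenCheckAll GB₂ m nb₂ = true) (hdim₂ : dimCheck EB₂ dimL₂ m nb₂ = true)
    {y : Fin (nv + 1) → ℝ} (hy0 : y 0 = 1) (hρ : ∀ v : Fin (nv + 1), v ≠ 0 → |y v| ≤ (w v.val : ℝ) / (w 0 : ℝ))
    (hagg : (rhsN : ℝ) / (D : ℝ) ≤ ∑ v : Fin (nv + 1), ((RN.getD v.val 0 : ℤ) : ℝ) / (D : ℝ) * y v)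
    (hpsd : ∀ k : Fin nb, (redE EB k.val (dimL.getD k.val 0) (nv + 1) y).PosSemidef)
    (hpsd₂ : ∀ k : Fin nb₂, (redE EB₂ k.val (dimL₂.getD k.val 0) (nv + 1) y).PosSemidef) :
    ((lower : ℚ) : ℝ) ≤ ∑ v : Fin (nv + 1), ((coef cZ v.val : ℤ) : ℝ) * y v := by
  have hD' : (0 : ℝ) < D := by exact_mod_cast hD
  have hq' : (0 : ℝ) < q := by exact_mod_cast hq
  have hw0' : (0 : ℝ) < w 0 := by exact_mod_cast hw0
  have hP : (0 : ℝ) < 4 ^ K := by positivity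
  have hDPq : (0 : ℝ) < (D : ℝ) * 4 ^ K * q := mul_pos (mul_pos hD' hP) hq'
  -- the aggregated row as the inequality slot
  have hineq : ∀ i : Fin 1, ∑ v : Fin (nv + 1), (-(((RN.getD v.val 0 : ℤ) : ℝ) / (D : ℝ))) * y v ≤ -((rhsN : ℝ) / (D : ℝ)) :=
    fun _ => by
      have e : ∑ v : Fin (nv + 1), (-(((RN.getD v.val 0 : ℤ) : ℝ) / (D : ℝ))) * y v =
          -(∑ v : Fin (nv + 1), ((RN.getD v.val 0 : ℤ) : ℝ) / (D : ℝ) * y v) := by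
        rw [← Finset.sum_neg_distrib]; exact Finset.sum_congr rfl fun v _ => by ring
      rw [e]; exact neg_le_neg hagg
  have h := JanssonChaykinKeil.lmiForm_bound (V := Fin (nv + 1)) (E := Fin 0) (I := Fin 1)
    (K := Fin nb ⊕ Fin nb₂) (σ := fun _ => Fin m)
    (fun v => ((coef cZ v.val : ℤ) : ℝ)) 0 0
    (fun i => Fin.elim0 i) (fun i => Fin.elim0 i)
    (fun _ v => -(((RN.getD v.val 0 : ℤ) : ℝ) / (D : ℝ))) (fun _ => -((rhsN : ℝ) / (D : ℝ)))
    (fun _ => 0)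
    (Sum.elim (fun k v => (fzE EB k.val m v.val).map (Int.cast : ℤ → ℝ))
      (fun k v => (fzE EB₂ k.val m v.val).map (Int.cast : ℤ → ℝ)))
    (fun v => (w v.val : ℝ) / (w 0 : ℝ))
    (fun k => trace ((0 : Matrix (Fin m) (Fin m) ℝ) + ∑ v, y v • Sum.elim
      (fun k v => (fzE EB k.val m v.val).map (Int.cast : ℤ → ℝ))
      (fun k v => (fzE EB₂ k.val m v.val).map (Int.cast : ℤ → ℝ)) k v))
    (y := y) hy0 hρ (fun i => Fin.elim0 i) hineq
    (fun k => by
      rcases k with k | k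
      · rw [zero_add]; exact posSemidef_gramE_of_redE hdim k.isLt (hpsd k)
      · rw [zero_add]; exact posSemidef_gramE_of_redE hdim₂ k.isLt (hpsd₂ k))
    (fun k => le_rfl)
    (fun i => Fin.elim0 i) (fun _ => 1) (fun _ => zero_le_one)
    (Sum.elim (fun k => zr (GB.getD k.val []) m K) (fun k => ((1 : ℝ) / q) • zr (GB₂.getD k.val []) m K))
    (fun _ => 0)
    (fun k => by
      rcases k with k | k
      · simpa using zr_posSemidef K (lenCheck_of_all hlen k)
      · simpa using (zr_posSemidef K (lenCheck_of_all hlen₂ k)).smul (by positivity))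
    (fun v => ((resNW GB EB nb m GB₂ EB₂ nb₂ cZ RN ((4 : ℤ) ^ K) (D : ℤ) (q : ℤ) v.val : ℤ) : ℝ) /
      ((D : ℝ) * 4 ^ K * q))
    (fun v => by
      simp only [Finset.univ_unique, Fin.default_eq_zero, Finset.sum_singleton, one_mul,
        Finset.univ_eq_empty, Finset.sum_empty, Fintype.sum_sum_type, Sum.elim_inl, Sum.elim_inr]
      rw [sum_trace_zr_mul_fzE_eq_trZ GB EB nb m K v, sum_trace_zr_div_mul_fzE_eq_trZ GB₂ EB₂ nb₂ m K (q : ℝ) v,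
        resNW]
      push_cast
      field_simp
      ring)
    (((resNW GB EB nb m GB₂ EB₂ nb₂ cZ RN ((4 : ℤ) ^ K) (D : ℤ) (q : ℤ) 0 : ℤ) : ℝ) / ((D : ℝ) * 4 ^ K * q) +
      (rhsN : ℝ) / (D : ℝ))
    (by simp)
  -- simplify the JCK conclusion
  simp only [min_self, abs_zero, zero_mul, Finset.sum_const_zero, sub_zero, add_zero] at h
  -- the window statement
  obtain ⟨_, hS⟩ := hwin
  rw [Nat.sub_zero, Finset.sum_range_succ'] at hS
  simp only [zero_add, gSpecW, Nat.add_one_ne_zero, if_false, if_true] at hS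
  -- the final check, cast to ℝ
  have hfin' : ((lower : ℚ) : ℝ) ≤
      (((rhsN * 4 ^ K * q * (w 0) - S : ℤ) : ℚ) : ℝ) / ((D : ℝ) * 4 ^ K * q * (w 0)) := by
    rw [finalCheckWW, decide_eq_true_eq] at hfin
    have := (Rat.cast_le (K := ℝ)).mpr hfin
    push_cast at this ⊢
    exact this
  -- Σ_{v ≠ 0} |r v| ρ v as a range sum over ℕ
  have herase : ∑ v ∈ Finset.univ.erase (0 : Fin (nv + 1)),
      |((resNW GB EB nb m GB₂ EB₂ nb₂ cZ RN ((4 : ℤ) ^ K) (D : ℤ) (q : ℤ) v.val : ℤ) : ℝ) / ((D : ℝ) * 4 ^ K * q)| *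
        ((w v.val : ℝ) / (w 0 : ℝ)) =
      ∑ i ∈ Finset.range nv,
        |((resNW GB EB nb m GB₂ EB₂ nb₂ cZ RN ((4 : ℤ) ^ K) (D : ℤ) (q : ℤ) (i + 1) : ℤ) : ℝ) / ((D : ℝ) * 4 ^ K * q)| *
          ((w (i + 1) : ℝ) / (w 0 : ℝ)) := by
    have h1 := Finset.add_sum_erase (Finset.univ : Finset (Fin (nv + 1)))
      (fun v => |((resNW GB EB nb m GB₂ EB₂ nb₂ cZ RN ((4 : ℤ) ^ K) (D : ℤ) (q : ℤ) v.val : ℤ) : ℝ) /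
        ((D : ℝ) * 4 ^ K * q)| * ((w v.val : ℝ) / (w 0 : ℝ)))
      (Finset.mem_univ 0)
    rw [Fin.sum_univ_succ] at h1
    have h2 := add_left_cancel h1
    rw [h2, ← Fin.sum_univ_eq_sum_range]
    rfl
  rw [herase] at h
  refine le_trans hfin' (le_trans (le_of_eq ?_) h)
  -- the identity (rhsN·4^K·q·W₀ − S)/(D·4^K·q·W₀) = r 0 + rhsN/D − Σ |r (i+1)| · w (i+1) / W₀
  have habs : ∀ i ∈ Finset.range nv,
      |((resNW GB EB nb m GB₂ EB₂ nb₂ cZ RN ((4 : ℤ) ^ K) (D : ℤ) (q : ℤ) (i + 1) : ℤ) : ℝ) / ((D : ℝ) * 4 ^ K * q)| *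
          ((w (i + 1) : ℝ) / (w 0 : ℝ)) =
        (|((resNW GB EB nb m GB₂ EB₂ nb₂ cZ RN ((4 : ℤ) ^ K) (D : ℤ) (q : ℤ) (i + 1) : ℤ) : ℝ)| * (w (i + 1) : ℝ)) /
          ((D : ℝ) * 4 ^ K * q * (w 0)) := by
    intro i _
    rw [abs_div, abs_of_pos hDPq]
    field_simp
  rw [Finset.sum_congr rfl habs, ← Finset.sum_div]
  have hS' : ∑ i ∈ Finset.range nv,
      |((resNW GB EB nb m GB₂ EB₂ nb₂ cZ RN ((4 : ℤ) ^ K) (D : ℤ) (q : ℤ) (i + 1) : ℤ) : ℝ)| * (w (i + 1) : ℝ) =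
      (S : ℝ) + ((resNW GB EB nb m GB₂ EB₂ nb₂ cZ RN ((4 : ℤ) ^ K) (D : ℤ) (q : ℤ) 0 : ℤ) : ℝ) * (w 0 : ℝ) := by
    rw [hS]; push_cast; ring
  rw [hS']
  push_cast
  field_simp
  ring

/-- **Equality twin** (an aggregated EQUALITY row, e.g. a torus certificate with per-variable boxes). [folklore] -/
theorem objective_boundW {nv nb nb₂ m K D q : ℕ} (cZ : List (ℕ × ℤ)) (RN : List ℤ) (rhsN : ℤ)
    (GB : List (List (List ℤ))) (EB : List (List (List (List (ℕ × ℤ))))) (dimL : List ℕ)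
    (GB₂ : List (List (List ℤ))) (EB₂ : List (List (List (List (ℕ × ℤ))))) (dimL₂ : List ℕ)
    (w : ℕ → ℕ) (lower : ℚ) (S : ℤ)
    (hD : 0 < D) (hq : 0 < q) (hw0 : 0 < w 0)
    (hwin : WinOKW GB EB nb m GB₂ EB₂ nb₂ cZ RN ((4 : ℤ) ^ K) (D : ℤ) (q : ℤ) w 0 (nv + 1) S)
    (hfin : finalCheckWW rhsN S D K q (w 0) lower = true)
    (hlen : lenCheckAll GB m nb = true) (hdim : dimCheck EB dimL m nb = true)
    (hlen₂ : lenCheckAll GB₂ m nb₂ = true) (hdim₂ : dimCheck EB₂ dimL₂ m nb₂ = true)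
    {y : Fin (nv + 1) → ℝ} (hy0 : y 0 = 1) (hρ : ∀ v : Fin (nv + 1), v ≠ 0 → |y v| ≤ (w v.val : ℝ) / (w 0 : ℝ))
    (hagg : ∑ v : Fin (nv + 1), ((RN.getD v.val 0 : ℤ) : ℝ) / (D : ℝ) * y v = (rhsN : ℝ) / (D : ℝ))
    (hpsd : ∀ k : Fin nb, (redE EB k.val (dimL.getD k.val 0) (nv + 1) y).PosSemidef)
    (hpsd₂ : ∀ k : Fin nb₂, (redE EB₂ k.val (dimL₂.getD k.val 0) (nv + 1) y).PosSemidef) :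
    ((lower : ℚ) : ℝ) ≤ ∑ v : Fin (nv + 1), ((coef cZ v.val : ℤ) : ℝ) * y v :=
  objective_boundW_of_le cZ RN rhsN GB EB dimL GB₂ EB₂ dimL₂ w lower S hD hq hw0 hwin hfin hlen hdim hlen₂ hdim₂ hy0 hρ
    hagg.symm.le hpsd hpsd₂

end

end Summit.QuantumFields.GaugeBoot.Certificates.Sparse
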